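import Summits.ValiantsHypothesis.ValiantsHypothesis.Theorems.EquivariantDialPolyPermifyFixedVector
import Summits.ValiantsHypothesis.ValiantsHypothesis.Theorems.SymPencilEquivariantSdcNotQPYoungFixedVectorAlternating
import Summits.ValiantsHypothesis.ValiantsHypothesis.Theorems.EquivariantDialThresholdYoung
import HarnessLib

/-!
# Equivariant dial — polynomial permify, file D: transport to `𝔄_n × 𝔄_n`

Offer O-L1-29 «POLYNOMIAL PERMIFY» (decomposition workshop, lineage `decomp-val-lens-1`, g37; RULING bus 3382),
file D of five.  The `𝔖_n`-side input of file C — for EVERY `λ ⊢ n` a subgroup `P_λ ≤ 𝔖_n` of index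
`≤ 2 (f^λ)^4` fixing a nonzero vector of the Specht module `S^λ` (`exists_polyIndex_fixed`) — is transported
to representations of `𝔄_n` and then to `𝔄_n × 𝔄_n →* GL_k ℂ`:

* `alternating_fixed_vector_family`: the tree's `alternating_fixed_vector` (induction to `𝔖_n` in the
  function model, an irreducible subrepresentation, completeness of the Specht modules, evaluation at a point)
  re-walked with an ARBITRARY family `ι λ ≤ 𝔖_n` of subgroups fixing a nonzero vector of `S^λ` in place of
  the Young row groups: every nonzero finite-dimensional `V` has `λ` with `f^λ ≤ 2 dim V` and `Y ≤ 𝔄_n` of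
  index `≤ [𝔖_n : ι λ]` fixing a nonzero vector;
* `polyFixedVector`: the tree's `youngFixedVector_of_budget` re-walked with `ι λ := P_λ`: every
  `σ : 𝔄_n × 𝔄_n →* GL_k ℂ`, `k ≥ 1`, has a nonzero functional fixed by a subgroup of index
  `≤ (2 (2k)^4)² = 1024 k^8` — POLYNOMIAL in `k`, with no dependence on `n`.

LABEL (RULING bus 3382, verbatim). O-L1-29 (lens-1 g37): ELEMENTARY-COMBINATORIAL · NEW-COMBINATION leaning NEW-INPUT (𝔖_n-side: for EVERY λ ⊢
n a COMMUTING PAIR R′ ≤ R_λ, C′ ≤ C_λ with the explicit co-volume law n! ≤ (f^λ)^4·|R′|·|C′| by greedy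
first-row/first-column peeling + the power-saving hook inequality (⋆G₄), and the MIXED Young eigenvector
B′_{C′}·c_λ, giving a subgroup R′·(C′ ∩ 𝔄_n) of index ≤ 2(f^λ)^4 fixing a nonzero Specht vector — a
statement of Larsen–Shalev virtual-degree type (LS08 Thm 2.2: n!/Π aᵢ! bᵢ! = n·D(λ) ≤ n·d_λ^{1+o(1)} for the
FROBENIUS commuting pair, asymptotically sharper but with an ineffective threshold; Teyssier–Thévenin 2024
Thm 1.5: D(λ) ≤ d_λ^{1+C/ln n}) proved here in explicit all-n form by an elementary route and pointed at
equivariant determinantal symmetry for the first time × the g33–g36 permify / Dawar–Wilsenach rate /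
heredity chain made budget-generic in O-L1-28) · PERMIFY BECOMES POLYNOMIAL: m′ ≤ 4096 m^10, no n-dependence
(g36: (n+1)^{2τ}, n^{O(log s)}); diagonal RATE edc_Δ(per_n) ≥ 2^{Ω(n)} i.o. (restricted Δ-model,
Dawar–Wilsenach class, constant uncomputed; Grenet's 2^n − 1 matched up to the constant in the exponent,
g36: 2^{Ω(n/log n)}); HEAD LAW without the log factor: EVERY diagonal head Δ(𝔖_{t(m)} ⊕ 1) with t(m)/log₂ m
→ ∞ HARD·KERNEL (one theorem over t), instance t = log₂ m·log₂ log₂ m = the top edge of the g36 residual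
sliver · the sliver narrows to log₂ m/log₂ log₂ m ≲ t ≲ C·log₂ m (contains t = log₂ m) and stays UNDECIDED ·
IDEA-NEEDED — out of reach of every rate/permify engine modulo edc_Δ(per_n) = 2^{Θ(n)}: the diagonal-head
dial is EXHAUSTED for rate engines; index-law-beating, P-ROW and cyclic notches untouched · 0 S-currency ·
closes NO item · VP ≠ VNP untouched

HONEST BOUNDARY: 0 S-currency; closes NO item; `EqHard` conclusions are S-implied (S ⇒ W ⇒ EqHard H); the
rate conclusion n ≤ a(L n + 1) i.o. (edc_Δ(per_n) ≥ 2^{n/a − 1} infinitely often) is a restricted-model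
lower bound of Dawar–Wilsenach class (Δ𝔖_n-equivariant = symmetric model) with an UNCOMPUTED constant a (it
depends on the Dawar–Wilsenach ε and the circuit-conversion exponent e, both ∃-packaged in the tree), not a
statement about dc(per_m); it matches Grenet's equivariant upper bound 2^n − 1 only up to that constant in
the exponent; permify is POLYNOMIAL in the matrix size (m′ ≤ 4096 m^10, exponent not optimised: the
co-volume exponent 4 in n! ≤ (f^λ)^4 |R′||C′| is what the termwise scheme (⋆G₄) certifies, numerically 3
suffices); EVERY diagonal head with t(m)/log₂ m → ∞ is HARD·KERNEL, but the residual sliver log₂ m/log₂ log₂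
m ≲ t(m) ≲ C·log₂ m (it contains t = log₂ m) stays UNDECIDED · IDEA-NEEDED and is out of reach of every
rate/permify engine unless edc_Δ(per_n) is 2^{ω(n)} (its heads have order t! = m^{Θ(log log m)}: above the
g33 index law, and a PolyEquivariant head t = C·log₂ m only produces Δ𝔖_n-ADRs of size 2^{O(n/C)}, below
what any 2^{Ω(n)}-class lower bound detects) — closing it needs an index-law-beating engine (or a
superexponential Δ-lower bound, which nothing suggests); files D/E re-walk tree proofs
(alternating_fixed_vector, youngFixedVector_of_budget, diag_rate_nearExp, nearExp_of_heredity,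
eqHard_of_nearExpHeredity) with the new subgroup family plugged in, the new mathematics is files A–C
(commuting pairs, (⋆G₄), the mixed eigenvector); P-ROW and the cyclic notches Δ⟨π⟩ of superpolynomial order
are NOT touched; stmt-23702 / VP ≠ VNP untouched.

This file is a TRANSCRIPTION of two tree proofs with the new subgroup family plugged in; the new
mathematics of O-L1-29 is files A–C.  The residual sliver of the dial stays UNDECIDED · IDEA-NEEDED.
References: [cite: JamesKerber1981, 1.5 and 7.1] [cite: FrameRobinsonThrallCJM1954, Theorem 1]
[cite: LandsbergRessayre2017, Theorem 2.5.5] [cite: DawarWilsenach2025, Theorem 2].  Theorems only; no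
definitions (the induced module and the contragredient action are built inside the proofs).
-/

noncomputable section

set_option linter.dupNamespace false

namespace Summit.ValiantsHypothesis.ValiantsHypothesis.Theorems.EquivariantDialPolyPermify

open Matrix Literature.NumberTheory.DiophantineGeometry
open Summit.ValiantsHypothesis.ValiantsHypothesis.Theorems.SymPencilEquivariantSdcNotQP.YoungBounds

/-! ### Fixed vectors of an arbitrary Specht-fixing family in representations of `𝔄_n` -/

/-- **Fixed vectors in representations of `𝔄_n`, for an arbitrary Specht-fixing family.**  Let `ι λ ≤ 𝔖_n`
fix a nonzero vector of `S^λ` for every `λ ⊢ n`.  Every nonzero finite-dimensional complex representation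
`V` of `𝔄_n` admits `λ ⊢ n` with `f^λ ≤ 2 dim V` and a subgroup `Y ≤ 𝔄_n` of index `≤ [𝔖_n : ι λ]`
(a conjugate of `ι λ ∩ 𝔄_n`) fixing a nonzero vector of `V` (transcription of the tree's
`alternating_fixed_vector`: induction, completeness, evaluation). [folklore; transcription] -/
theorem alternating_fixed_vector_family (n : ℕ)
    (ι : Nat.Partition n → Subgroup (Equiv.Perm (Fin n)))
    (hι : ∀ lam : Nat.Partition n, ∃ w : spechtIdeal ℂ lam, w ≠ 0 ∧
      ∀ p ∈ ι lam, spechtRep ℂ lam p w = w)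
    {V : Type} [AddCommGroup V] [Module ℂ V] [FiniteDimensional ℂ V] [Nontrivial V]
    (ρ : Representation ℂ ↥(alternatingGroup (Fin n)) V) :
    ∃ lam : Nat.Partition n, numStandardTableaux lam ≤ 2 * Module.finrank ℂ V ∧
      ∃ Y : Subgroup ↥(alternatingGroup (Fin n)), Y.index ≤ (ι lam).index ∧
        ∃ v : V, v ≠ 0 ∧ ∀ y ∈ Y, ρ y v = v := by
  classical
  -- the induced module `U ⊆ (𝔖_n → V)`
  let U : Submodule ℂ (Equiv.Perm (Fin n) → V) :=
    { carrier := {f | ∀ (a : ↥(alternatingGroup (Fin n))) (x : Equiv.Perm (Fin n)),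
        f ((a : Equiv.Perm (Fin n)) * x) = ρ a (f x)}
      zero_mem' := by intro a x; simp
      add_mem' := by
        intro f g hf hg a x
        simp only [Pi.add_apply, map_add, hf a x, hg a x]
      smul_mem' := by
        intro c f hf a x
        simp only [Pi.smul_apply, map_smul, hf a x] }
  have hU : ∀ f : Equiv.Perm (Fin n) → V, f ∈ U ↔
      ∀ (a : ↥(alternatingGroup (Fin n))) (x : Equiv.Perm (Fin n)),
        f ((a : Equiv.Perm (Fin n)) * x) = ρ a (f x) := fun f => Iff.rfl
  -- right translation
  have hmem : ∀ g : Equiv.Perm (Fin n), ∀ f : Equiv.Perm (Fin n) → V, f ∈ U →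
      (fun x => f (x * g)) ∈ U := by
    intro g f hf
    refine (hU _).2 fun a x => ?_
    rw [mul_assoc]
    exact (hU f).1 hf a (x * g)
  let T : Equiv.Perm (Fin n) → (U →ₗ[ℂ] U) := fun g =>
    { toFun := fun f => ⟨fun x => (f : Equiv.Perm (Fin n) → V) (x * g), hmem g f f.2⟩
      map_add' := fun f f' => rfl
      map_smul' := fun c f => rfl }
  have hT : ∀ (g : Equiv.Perm (Fin n)) (f : U) (x : Equiv.Perm (Fin n)),
      ((T g f : U) : Equiv.Perm (Fin n) → V) x = (f : Equiv.Perm (Fin n) → V) (x * g) :=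
    fun _ _ _ => rfl
  let π : Representation ℂ (Equiv.Perm (Fin n)) U :=
    { toFun := T
      map_one' := by
        apply LinearMap.ext
        intro f
        apply Subtype.ext
        funext x
        rw [hT, mul_one]
        rfl
      map_mul' := by
        intro g h
        apply LinearMap.ext
        intro f
        apply Subtype.ext
        funext x
        rw [hT, Module.End.mul_apply, hT, hT, mul_assoc] }
  have hπ : ∀ (g : Equiv.Perm (Fin n)) (f : U) (x : Equiv.Perm (Fin n)),
      ((π g f : U) : Equiv.Perm (Fin n) → V) x = (f : Equiv.Perm (Fin n) → V) (x * g) :=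
    fun _ _ _ => rfl
  clear_value π T U
  -- `U ≠ 0`
  obtain ⟨v₀, hv₀⟩ := exists_ne (0 : V)
  let f₀ : Equiv.Perm (Fin n) → V := fun x =>
    if hx : x ∈ (alternatingGroup (Fin n)) then ρ ⟨x, hx⟩ v₀ else 0
  have hf₀ : f₀ ∈ U := by
    refine (hU f₀).2 ?_
    intro a x
    by_cases hx : x ∈ (alternatingGroup (Fin n))
    · have hax : (a : Equiv.Perm (Fin n)) * x ∈ (alternatingGroup (Fin n)) := mul_mem a.2 hx
      have hprod : (⟨(a : Equiv.Perm (Fin n)) * x, hax⟩ : ↥(alternatingGroup (Fin n))) = a * ⟨x, hx⟩ :=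
        rfl
      simp only [f₀, dif_pos hx, dif_pos hax, hprod, map_mul, Module.End.mul_apply]
    · have hax : (a : Equiv.Perm (Fin n)) * x ∉ (alternatingGroup (Fin n)) := by
        intro h
        apply hx
        have := mul_mem (inv_mem a.2) h
        rwa [inv_mul_cancel_left] at this
      simp only [f₀, dif_neg hx, dif_neg hax, map_zero]
  have hf₀ne : (⟨f₀, hf₀⟩ : U) ≠ 0 := by
    intro h
    have h1 : f₀ 1 = 0 := by
      have := congrArg (fun f : U => (f : Equiv.Perm (Fin n) → V) 1) h
      simpa using this
    have h2 : f₀ 1 = v₀ := by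
      have h1A : (1 : Equiv.Perm (Fin n)) ∈ (alternatingGroup (Fin n)) :=
        one_mem (alternatingGroup (Fin n))
      have hone : (⟨(1 : Equiv.Perm (Fin n)), h1A⟩ : ↥(alternatingGroup (Fin n))) = 1 := rfl
      simp only [f₀, dif_pos h1A, hone, map_one, Module.End.one_apply]
    exact hv₀ (h2 ▸ h1)
  haveI : Nontrivial U := ⟨⟨_, 0, hf₀ne⟩⟩
  -- an irreducible subrepresentation and its Specht model
  obtain ⟨σ₁, hσ₁, hirr⟩ := exists_irreducible_subrepresentation π
  haveI := hirr
  obtain ⟨lam, ⟨e⟩⟩ :=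
    exists_equiv_spechtRep_of_isIrreducible_holds (k := ℂ) (V := ↥σ₁.toSubmodule) σ₁.toRepresentation
  -- dimension count
  have h4 : Module.finrank ℂ U ≤ 2 * Module.finrank ℂ V := by
    have hs : ∃ s : Equiv.Perm (Fin n), ∀ x : Equiv.Perm (Fin n),
        x ∈ (alternatingGroup (Fin n)) ∨ x * s⁻¹ ∈ (alternatingGroup (Fin n)) := by
      by_cases h : ∃ s : Equiv.Perm (Fin n), s ∉ (alternatingGroup (Fin n))
      · obtain ⟨s, hs⟩ := h
        refine ⟨s, fun x => ?_⟩
        by_cases hx : x ∈ (alternatingGroup (Fin n))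
        · exact Or.inl hx
        · right
          rw [Equiv.Perm.mem_alternatingGroup] at hx hs ⊢
          have hx' : Equiv.Perm.sign x = -1 := (Int.units_eq_one_or _).resolve_left hx
          have hs' : Equiv.Perm.sign s = -1 := (Int.units_eq_one_or _).resolve_left hs
          rw [map_mul, map_inv, hx', hs', mul_inv_cancel]
      · refine ⟨1, fun x => Or.inl ?_⟩
        by_contra hx
        exact h ⟨x, hx⟩
    obtain ⟨s, hs⟩ := hs
    let ev : U →ₗ[ℂ] V × V :=
      { toFun := fun f => ((f : Equiv.Perm (Fin n) → V) 1, (f : Equiv.Perm (Fin n) → V) s)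
        map_add' := fun f g => rfl
        map_smul' := fun c f => rfl }
    have hev : Function.Injective ev := by
      intro f g hfg
      apply Subtype.ext
      funext x
      have h1 : (f : Equiv.Perm (Fin n) → V) 1 = (g : Equiv.Perm (Fin n) → V) 1 := congrArg Prod.fst hfg
      have h2 : (f : Equiv.Perm (Fin n) → V) s = (g : Equiv.Perm (Fin n) → V) s := congrArg Prod.snd hfg
      rcases hs x with hx | hx
      · have hf := (hU f).1 f.2 ⟨x, hx⟩ 1
        have hg := (hU g).1 g.2 ⟨x, hx⟩ 1
        simp only [mul_one] at hf hg
        rw [hf, hg, h1]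
      · have hf := (hU f).1 f.2 ⟨x * s⁻¹, hx⟩ s
        have hg := (hU g).1 g.2 ⟨x * s⁻¹, hx⟩ s
        simp only [inv_mul_cancel_right] at hf hg
        rw [hf, hg, h2]
    calc Module.finrank ℂ U ≤ Module.finrank ℂ (V × V) := LinearMap.finrank_le_finrank_of_injective hev
      _ = 2 * Module.finrank ℂ V := by rw [Module.finrank_prod]; ring
  have hdim : numStandardTableaux lam ≤ 2 * Module.finrank ℂ V := by
    have h1 : Module.finrank ℂ (spechtIdeal ℂ lam) = numStandardTableaux lam :=
      finrank_spechtIdeal_holds (k := ℂ) lam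
    have h2 : Module.finrank ℂ σ₁.toSubmodule = Module.finrank ℂ (spechtIdeal ℂ lam) :=
      e.toLinearEquiv.finrank_eq
    have h3 : Module.finrank ℂ σ₁.toSubmodule ≤ Module.finrank ℂ U := Submodule.finrank_le _
    omega
  refine ⟨lam, hdim, ?_⟩
  -- a nonzero vector of `S^λ` fixed by `ι λ`
  obtain ⟨w, hw0, hw⟩ := hι lam
  -- transport to `σ₁ ⊆ U`
  set u : σ₁.toSubmodule := e.symm w with hu
  have hu0 : u ≠ 0 := by
    intro h
    apply hw0
    apply (EquivLike.injective e.symm)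
    rw [← hu, h, map_zero]
  have hufix : ∀ p ∈ ι lam, σ₁.toRepresentation p u = u := by
    intro p hp
    rw [hu]
    have h := Representation.IntertwiningMap.isIntertwining _ _ e.symm.toIntertwiningMap p w
    rw [hw p hp, Representation.Equiv.coe_toIntertwiningMap] at h
    exact h.symm
  set uf : Equiv.Perm (Fin n) → V := ((u : U) : Equiv.Perm (Fin n) → V) with huf
  have hufU : uf ∈ U := (u : U).2
  have hfixfun : ∀ p ∈ ι lam, ∀ x, uf (x * p) = uf x := by
    intro p hp x
    have h1 : ((σ₁.toRepresentation p u : σ₁.toSubmodule) : U) = π p (u : U) := rfl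
    have h2 := congrArg (fun z : σ₁.toSubmodule => ((z : U) : Equiv.Perm (Fin n) → V) x) (hufix p hp)
    rw [h1, hπ] at h2
    rw [huf]
    exact h2
  have hne : ∃ x₀, uf x₀ ≠ 0 := by
    by_contra h
    rw [not_exists] at h
    apply hu0
    have h1 : uf = 0 := funext fun x => not_not.mp (h x)
    have h2 : (u : U) = 0 := Subtype.ext h1
    exact Subtype.ext (by rw [h2]; rfl)
  obtain ⟨x₀, hx₀⟩ := hne
  refine ⟨(((ι lam ⊓ (alternatingGroup (Fin n))).map
      ((MulAut.conj x₀ : Equiv.Perm (Fin n) ≃* Equiv.Perm (Fin n)) :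
        Equiv.Perm (Fin n) →* Equiv.Perm (Fin n))).subgroupOf (alternatingGroup (Fin n))),
    index_conj_inf_subgroupOf_le (ι lam) x₀, uf x₀, hx₀, fun y hy => ?_⟩
  rw [Subgroup.mem_subgroupOf] at hy
  obtain ⟨p, ⟨hpR, _⟩, hpy⟩ := Subgroup.mem_map.mp hy
  have h1 : uf ((y : Equiv.Perm (Fin n)) * x₀) = ρ y (uf x₀) := (hU uf).1 hufU y x₀
  rw [← h1]
  have h2 : (y : Equiv.Perm (Fin n)) * x₀ = x₀ * p := by
    rw [← hpy]
    change (MulAut.conj x₀) p * x₀ = x₀ * p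
    rw [MulAut.conj_apply, inv_mul_cancel_right]
  rw [h2]
  exact hfixfun p hpR x₀

/-! ### The polynomial fixed-vector theorem for `𝔄_n × 𝔄_n →* GL_k ℂ` -/

/-- **Polynomial fixed vectors.**  Every `σ : 𝔄_n × 𝔄_n →* GL_k ℂ`, `k ≥ 1`, has a nonzero functional
fixed by a subgroup of index `≤ 1024 k^8`: `alternating_fixed_vector_family` with the family
`P_λ` of `exists_polyIndex_fixed` (`[𝔖_n : P_λ] ≤ 2 (f^λ)^4 ≤ 2 (2k)^4` when `f^λ ≤ 2k`), first for the
first factor acting contragrediently on `ℂ^k`, then for the second factor acting on the fixed subspace;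
`Y = Y₁ × Y₂`, `ℓ = ⟨w, ·⟩` (transcription of the tree's `youngFixedVector_of_budget`).
[folklore; transcription] [cite: JamesKerber1981, 1.5 and 7.1] -/
theorem polyFixedVector (n k : ℕ)
    (σ : ↥(alternatingGroup (Fin n)) × ↥(alternatingGroup (Fin n)) →* GL (Fin k) ℂ) (hk : 1 ≤ k) :
    ∃ Y : Subgroup (↥(alternatingGroup (Fin n)) × ↥(alternatingGroup (Fin n))),
      Y.index ≤ 1024 * k ^ 8 ∧ ∃ ℓ : (Fin k → ℂ) →ₗ[ℂ] ℂ, ℓ ≠ 0 ∧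
        ∀ y ∈ Y, ℓ ∘ₗ Matrix.toLin' (σ y : Matrix (Fin k) (Fin k) ℂ) = ℓ := by
  classical
  -- the Specht-fixing family of file C
  choose ι hι using fun lam : Nat.Partition n => exists_polyIndex_fixed lam
  have hιidx : ∀ lam : Nat.Partition n, numStandardTableaux lam ≤ 2 * k →
      (ι lam).index ≤ 2 * (2 * k) ^ 4 := by
    intro lam hlam
    calc (ι lam).index ≤ 2 * numStandardTableaux lam ^ 4 := (hι lam).1
      _ ≤ 2 * (2 * k) ^ 4 := by gcongr
  have hιfix : ∀ lam : Nat.Partition n, ∃ w : spechtIdeal ℂ lam, w ≠ 0 ∧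
      ∀ p ∈ ι lam, spechtRep ℂ lam p w = w := fun lam => (hι lam).2
  set G := ↥(alternatingGroup (Fin n)) with hG
  -- the contragredient action on `ℂ^k`
  let ρ' : (G × G) →* ((Fin k → ℂ) →ₗ[ℂ] (Fin k → ℂ)) :=
    { toFun := fun g => Matrix.toLin' ((σ g⁻¹ : Matrix (Fin k) (Fin k) ℂ)ᵀ)
      map_one' := by
        rw [inv_one, map_one, Units.val_one, Matrix.transpose_one, Matrix.toLin'_one]
        rfl
      map_mul' := fun g h => by
        rw [_root_.mul_inv_rev, map_mul, Units.val_mul, Matrix.transpose_mul, Matrix.toLin'_mul]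
        rfl }
  have hρ' : ∀ g, ρ' g = Matrix.toLin' ((σ g⁻¹ : Matrix (Fin k) (Fin k) ℂ)ᵀ) := fun g => rfl
  haveI : Nonempty (Fin k) := ⟨⟨0, hk⟩⟩
  -- first factor
  let ρ₁ : Representation ℂ G (Fin k → ℂ) := ρ'.comp (MonoidHom.inl G G)
  have hρ₁ : ∀ a : G, ρ₁ a = ρ' (a, 1) := fun a => rfl
  obtain ⟨lam₁, hdim₁, Y₁, hY₁, v, hv0, hv⟩ := alternating_fixed_vector_family n ι hιfix ρ₁
  rw [Module.finrank_fin_fun] at hdim₁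
  have hidx₁ : Y₁.index ≤ 2 * (2 * k) ^ 4 := hY₁.trans (hιidx lam₁ hdim₁)
  -- the subspace of `Y₁`-fixed vectors, invariant under the second factor
  let W : Submodule ℂ (Fin k → ℂ) :=
    { carrier := {w | ∀ y ∈ Y₁, ρ₁ y w = w}
      zero_mem' := by intro y _; simp
      add_mem' := by
        intro a b ha hb y hy
        rw [map_add, ha y hy, hb y hy]
      smul_mem' := by
        intro r a ha y hy
        rw [map_smul, ha y hy] }
  have hW : ∀ w, w ∈ W ↔ ∀ y ∈ Y₁, ρ₁ y w = w := fun w => Iff.rfl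
  have hcomm : ∀ (a b : G) (w : Fin k → ℂ), ρ' (a, 1) (ρ' (1, b) w) = ρ' (1, b) (ρ' (a, 1) w) := by
    intro a b w
    rw [← Module.End.mul_apply, ← map_mul, ← Module.End.mul_apply, ← map_mul]
    have h : ((a, 1) : G × G) * (1, b) = (1, b) * (a, 1) := by ext <;> simp
    rw [h]
  have hWinv : ∀ (b : G), ∀ w ∈ W, ρ' (1, b) w ∈ W := by
    intro b w hw y hy
    rw [hρ₁, hcomm, ← hρ₁, hw y hy]
  let ρ₂ : Representation ℂ G W :=
    { toFun := fun b => (ρ' (1, b)).restrict (hWinv b)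
      map_one' := by
        apply LinearMap.ext; intro w; apply Subtype.ext
        simp only [LinearMap.coe_restrict_apply, Module.End.one_apply]
        rw [show ((1 : G), (1 : G)) = (1 : G × G) from rfl, map_one, Module.End.one_apply]
      map_mul' := fun a b => by
        apply LinearMap.ext; intro w; apply Subtype.ext
        simp only [LinearMap.coe_restrict_apply, Module.End.mul_apply]
        rw [← Module.End.mul_apply, ← map_mul]
        rfl }
  have hρ₂ : ∀ (b : G) (w : W), ((ρ₂ b w : W) : Fin k → ℂ) = ρ' (1, b) (w : Fin k → ℂ) :=
    fun b w => rfl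
  haveI : Nontrivial W := ⟨⟨⟨v, (hW v).2 hv⟩, 0, fun h => hv0 (congrArg Subtype.val h)⟩⟩
  obtain ⟨lam₂, hdim₂, Y₂, hY₂, w, hw0, hw⟩ := alternating_fixed_vector_family n ι hιfix ρ₂
  have hdim₂' : numStandardTableaux lam₂ ≤ 2 * k := by
    have : Module.finrank ℂ W ≤ k := by
      calc Module.finrank ℂ W ≤ Module.finrank ℂ (Fin k → ℂ) := Submodule.finrank_le W
        _ = k := Module.finrank_fin_fun ℂ
    omega
  have hidx₂ : Y₂.index ≤ 2 * (2 * k) ^ 4 := hY₂.trans (hιidx lam₂ hdim₂')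
  -- the subgroup and the functional
  refine ⟨Y₁.prod Y₂, ?_, ?_⟩
  · rw [Subgroup.index_prod]
    calc Y₁.index * Y₂.index ≤ (2 * (2 * k) ^ 4) * (2 * (2 * k) ^ 4) := Nat.mul_le_mul hidx₁ hidx₂
      _ = 1024 * k ^ 8 := by ring
  · set wv : Fin k → ℂ := (w : Fin k → ℂ) with hwv
    have hwv0 : wv ≠ 0 := fun h => hw0 (Subtype.ext h)
    -- `wv` is fixed by `ρ' y` for every `y ∈ Y₁ × Y₂`
    have hfixed : ∀ y ∈ Y₁.prod Y₂, ρ' y wv = wv := by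
      rintro ⟨y₁, y₂⟩ hy
      rw [Subgroup.mem_prod] at hy
      obtain ⟨hy₁, hy₂⟩ := hy
      have h1 : ((y₁, y₂) : G × G) = (y₁, 1) * (1, y₂) := by ext <;> simp
      have h2 : ρ' (1, y₂) wv = wv := by
        have := congrArg Subtype.val (hw y₂ hy₂)
        rwa [hρ₂] at this
      have h3 : ρ' (y₁, 1) wv = wv := by rw [← hρ₁]; exact (hW wv).1 w.2 y₁ hy₁
      rw [h1, map_mul, Module.End.mul_apply, h2, h3]
    -- the functional `x ↦ wv ⬝ᵥ x`
    let ℓ : (Fin k → ℂ) →ₗ[ℂ] ℂ :=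
      { toFun := fun x => wv ⬝ᵥ x
        map_add' := fun x y => dotProduct_add wv x y
        map_smul' := fun r x => by rw [dotProduct_smul]; rfl }
    have hℓ : ∀ x, ℓ x = wv ⬝ᵥ x := fun x => rfl
    refine ⟨ℓ, ?_, fun y hy => ?_⟩
    · intro h
      apply hwv0
      funext i
      have := congrArg (fun f : (Fin k → ℂ) →ₗ[ℂ] ℂ => f (Pi.single i 1)) h
      simp only [hℓ, dotProduct_single, mul_one, LinearMap.zero_apply] at this
      exact this
    · have hyinv : ρ' y⁻¹ wv = wv := hfixed y⁻¹ (inv_mem hy)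
      rw [hρ', inv_inv, Matrix.toLin'_apply, Matrix.mulVec_transpose] at hyinv
      apply LinearMap.ext
      intro x
      rw [LinearMap.comp_apply, hℓ, hℓ, Matrix.toLin'_apply, Matrix.dotProduct_mulVec, hyinv]

end Summit.ValiantsHypothesis.ValiantsHypothesis.Theorems.EquivariantDialPolyPermify

end
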